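import Summits.Ventures.CertifiedManyBodySolver.Theorems.TcThermcert1VertexComposition
import Summits.Ventures.CertifiedManyBodySolver.Observables.ThermalRungLeaves
import HarnessLib

/-!
# Route «hubbard-tc-thermcert-1», crux K2 `TcThermcert1.ThermalStiffnessCeilingBoxb10_le_9o71` (stmt-Ventures-26382), line «vertex»:
# RUNG SOCKETS — the `β` ∕ level ∕ sub-box-GENERIC twin of the registered S4 machinery, and the box-wide rungs at `β·t = 6` and `β·t = 5`

Cell `pub/hubbard-tc` (MO-S3 × D-0154 (1) thermcert-1), crux-plan successor seat hub-tc-therm-plan-2 (agent planner-hub-tc-therm-plan-2-g0-0,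
2026-08-28). Crux workfile `Cruxes/ThermalStiffnessCeilingBoxb10_le_9o71/VertexRungSockets.lean`; bytes staged for a typist to land VERBATIM
(namespace line apart) as `Theorems/TcThermcert1VertexRungSockets.lean --supports stmt-Ventures-26382 --as helper` on a lead ruling.

HONEST FRAMING: one-sided CEILING chains under hypotheses; every `VertexCoverBoxAt β q U₁ U₂` below (like the registered S4 `VertexCoverBoxB10`)
is a finite frozen-dual certificate statement that is proved NOWHERE today — it is the producers' object; so nothing about the Hubbard model is
proved unconditionally in this file; no certificate, no number of record, no kelvin value and no `T_c` lives here; KT ceilings never assert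
superconductivity; NO lower bound on `T_c` is claimed; no summit, rung or crux statement is proved by this seat. The registered skeleton of
line «vertex» (`Lines/vertex.lean`, v4.2, sha16 55c235d25eb4162b; stub `stub_vertexCover : VertexCoverBoxB10`) is NOT touched: the rungs land in
helper mode, exactly as K1's `rung_b6` ∕ `rung_b5` (`Theorems/TcThermcert1TrialGeneratorSockets.lean`, RULINGS R129 ∕ R129a ∕ R133).

WHY (the K2-side twin of R129a). The line's composition (`Theorems/TcThermcert1VertexComposition.lean`, p618478) is written at the ONE point
`(β, level) = (10, 9/71)` on the ONE box `[79/10, 147/10]`: `CertDatum.lagr` hard-wires `β = 10` into the EEB and Bogoliubov row words. But every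
ingredient is `β`-generic in the tree — the hook `TrialGeneratorHook` (S1, p614740), the row admissibility `isThermalRowState_of_supportingMu` ∕
`exists_supportingMu_mem_band` (p615465, any `0 < β`), the per-word affinity lemmas `eebWord_affine β …` ∕ `bogWord_affine β …` (p616377), and the
box socket `ThermalRungLeaves.S3ThermalTcCeilingBoxAt_n7o8_tp0_of_leafAtBeta` (any `β`, `c`, `θ` with `(π/4)·c < 1/β ≤ θ`). The cell's milestone
logic (M-K1-R1, R129a) makes `β·t = 6` the first DECIDED rung of the trial-word lever for K1; the K2 analogue is the first BOX-WIDE (or sub-box)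
rung: a producer's cell cover at `β·t = 6`, level `21/100`, on the object-E box banks `S3ThermalTcCeilingBoxAt_n7o8_tp0 (1/6)` — KT-`T_c ≤ t/6`
on the whole box `U/t ∈ [7.9, 14.7]`, against today's box value of record `10/33` (energy class, kernel node `β·t = 33/10`,
`Certificates/HubbardSquare_n7o8_TKT_C3floor_r529_kernelQuad_b33o10.lean`, conditional on the named producer certificates; the hypothesis-free
instance of THIS decl family is `θ ≥ 1/π`, `S3ThermalTcCeilingBoxAt_n7o8_tp0_of_inv_pi_le`) — WITHOUT re-typing anything. This file supplies exactly those sockets, sorry-free: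

* §1 `lagrAt β d`, `RectCertAt β d`, `LagrAffineAt β d`, `VertexCoverBoxAt β q U₁ U₂`, `TrialGeneratorCertificateBoxAt β q U₁ U₂` — the
  `β`-generic objects; `lagrAt 10 d = d.lagr` and `RectCertAt 10 d = d.RectCert` hold by `rfl`, and
  `VertexCoverBoxB10 ↔ VertexCoverBoxAt 10 (9/71) (79/10) (147/10)` (the registered S4 is literally the `(10, 9/71, box)` instance);
* §2 the generic bookkeeping, PROVED: dominance `re_trialWord_le_lagrAt` on thermal row states at `β`, joint affinity `lagrAt_affine`
  (S3 at every `β`, same proof), the cell (corner) rule `lagrAt_le_of_rectCertAt`;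
* §3 the generic composition, PROVED: `certificateBoxAt_of_vertexCoverAt`, `boxLeafAt_of_certificateBoxAt` (hook S1 + row admissibility),
  `boxLeafAt_of_vertexCoverAt : 0 < β → 0 ≤ U₁ → VertexCoverBoxAt β q U₁ U₂ → ∀ U ∈ [U₁, U₂], ObsThermalStiffnessSeqCeilingAtBeta 0 U (7/8) β q`;
* §4 cover algebra for incremental production, PROVED: `vertexCoverBoxAt_of_strip` (ONE band-spanning strip cell with one datum IS a sub-box cover —
  the producer-facing entry point; `sliverCover_b6_of_strip` = its `[7.9, 8]` instance at `β·t = 6`), `vertexCoverBoxAt_union` (glue two adjacent sub-box covers), `vertexCoverBoxAt_mono`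
  (raise the level), `vertexCoverBoxAt_restrict` (shrink the sub-box), `muBand_enclosure` (the band at density `7/8` sits inside the RATIONAL-
  friendly strip `[−(2/7)/β − 4, 4 + U]`, so μ-spanning cells with rational corners discharge the band hypothesis);
* §5 the rungs, PROVED as implications: `rungBox_b6 : VertexCoverBoxAt 6 (21/100) (79/10) (147/10) → S3ThermalTcCeilingBoxAt_n7o8_tp0 (1/6)`
  (`(π/4)·(21/100) = 0.1649 < 1/6`), `rungBox_b5 : VertexCoverBoxAt 5 (14/55) (79/10) (147/10) → S3ThermalTcCeilingBoxAt_n7o8_tp0 (1/5)`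
  (`(π/4)·(14/55) = 0.19992 < 1/5`), `rungBox_b8 : VertexCoverBoxAt 8 (7/44) (79/10) (147/10) → S3ThermalTcCeilingBoxAt_n7o8_tp0 (1/8)` (the box twin of
  MILESTONE M-K1-R1(8), RULINGS R149 (b) ∕ R150; `(π/4)·(7/44) = 0.12495 < 1/8`), the sliver forms `subBoxLeaf_b6` ∕ `subBoxLeaf_b8` ∕ `sliverCover_b6_of_strip` ∕
  `sliverCover_b8_of_strip`, and the K2 instance `crux_of_vertexCoverAt : VertexCoverBoxAt 10 (9/71) (79/10) (147/10) → K2` by name.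

WHAT THIS IS NOT: not a certificate, not a re-registration, not a new item (BC6: helpers toward stmt-Ventures-26382); the lever test that prices
S4 (M-K1-R1: certified-able capture of the trial-word class at `β·t = 6`, KEEP ≥ 9 %, KILL < 1.5 %) prices these rungs identically, read at the
box's binding corner `U = 7.9`; if the trial-word class dies, §1–§4 still serve any row-state word class whose objective is affine in `(U, μ₀)`.

References: DLS1978 §2 eqs. (22′), (27), (28); FawziFawziScalet2024 Thm. 3.1; ArakiMoriya2003 Thm. 12.11; BratteliRobinsonII1997 Thm. 6.2.4;
WangEtAl2024 §III (frozen-dual ∕ corner certificates); Han2020Bootstrap §2–3; HazraVermaRanderia2019 eqs. (2)–(4); NelsonKosterlitz1977 eq. (1).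
-/

noncomputable section

namespace Summit.Ventures.CertifiedManyBodySolver.Cruxes.ThermalStiffnessCeilingBoxb10_le_9o71.VertexRungs

open Filter Topology Matrix Finset
open Literature.MathematicalPhysics.QuantumLattice
open Literature.MathematicalPhysics.QuantumLattice.ThermodynamicLimit
open Literature.MathematicalPhysics.QuantumFieldTheory
open Literature.MathematicalPhysics.StatisticalMechanics
open Literature.Probability.LatticeModels
open Summit.Ventures.CertifiedManyBodySolver.Observables
open Summit.Ventures.CertifiedManyBodySolver.Observables.ThermalRungLeaves
open Summit.Ventures.CertifiedManyBodySolver.Theorems.TcThermcert1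
open Summit.Ventures.CertifiedManyBodySolver.Theorems.TcThermcert1.Vertex
open Summit.Ventures.CertifiedManyBodySolver.Theses.TcThermcert1
open scoped ComplexConjugate ComplexOrder

/-! ## §1 The `β`-generic objects (at `β = 10` they ARE the registered ones) -/

/-- **The frozen-dual Lagrangian at inverse temperature `β`** (`t = 1`, `t′ = 0`, density `7/8` carried by the rows):
`L_d^β(U, μ₀; ω) = Re ω(W_a(U)) + Σ_st Re(y·ω(st(U,μ₀))) + Σ_eeb y·Re ω(eeb_β(U,μ₀)) + Σ_bog y·Re ω(bog_β(U))` — `CertDatum.lagr` with the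
hard-wired `10` replaced by `β`. [cite: WangEtAl2024, §III] -/
def lagrAt (β : ℝ) (d : CertDatum) (U μ₀ : ℝ) (ω : InfVolFermionState 2) : ℝ :=
  (ω.expect (box 2 (3 * d.r + 2)) (trialWord 0 U d.r d.a)).re +
    (d.st.map fun ρ => (ρ.y * ω.expect ρ.Λ' (stWord 0 U μ₀ ρ.hΛ ρ.A)).re).sum +
    (d.eeb.map fun ρ => ρ.y * (ω.expect ρ.Λ' (eebWord β 0 U μ₀ ρ.hΛ ρ.A ρ.s ρ.q)).re).sum +
    (d.bog.map fun ρ => ρ.y * (ω.expect ρ.Λ' (bogWord β 0 U ρ.hΛ ρ.A ρ.C)).re).sum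

/-- At `β = 10` the generic Lagrangian IS the registered one. [cite: WangEtAl2024, §III] -/
theorem lagrAt_ten (d : CertDatum) : lagrAt 10 d = d.lagr := rfl

/-- **Corner certificates at `β`** of the datum `d` on the cell `[U₁, U₂] × [μ₁, μ₂]` at level `c`, for every translation-invariant state of
density `7/8` (`CertDatum.RectCert` with `lagr` replaced by `lagrAt β`). [cite: WangEtAl2024, §III] -/
def RectCertAt (β : ℝ) (d : CertDatum) (U₁ U₂ μ₁ μ₂ c : ℝ) : Prop :=
  ∀ ω : InfVolFermionState 2, ω.IsTranslationInvariant → ω.density = 7 / 8 →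
    lagrAt β d U₁ μ₁ ω ≤ c ∧ lagrAt β d U₁ μ₂ ω ≤ c ∧ lagrAt β d U₂ μ₁ ω ≤ c ∧ lagrAt β d U₂ μ₂ ω ≤ c

/-- At `β = 10` the generic corner certificates ARE the registered ones. [cite: WangEtAl2024, §III] -/
theorem rectCertAt_ten (d : CertDatum) : RectCertAt 10 d = d.RectCert := rfl

/-- Joint affinity in `(U, μ₀)` of the generic Lagrangian (`CertDatum.LagrAffine` at `β`). [cite: WangEtAl2024, §III] -/
def LagrAffineAt (β : ℝ) (d : CertDatum) : Prop :=
  ∀ (p₁ p₂ q₁ q₂ θ : ℝ) (ω : InfVolFermionState 2),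
    lagrAt β d ((1 - θ) * p₁ + θ * q₁) ((1 - θ) * p₂ + θ * q₂) ω = (1 - θ) * lagrAt β d p₁ p₂ ω + θ * lagrAt β d q₁ q₂ ω

/-- **The generic cell-cover statement** at `(β, q)` on the sub-box `[U₁, U₂]`: a finite cover of the banded SUPPORTING set
`{(U, μ₀) : U ∈ [U₁, U₂], μ₀ ∈ band_β(U), μ₀ supporting for p(β; 1, 0, U; ·) at 7/8}` by rational cells, each carrying ONE frozen certificate
datum whose four corner certificates hold at level `q`. The registered S4 `VertexCoverBoxB10` is the instance `(10, 9/71, 79/10, 147/10)`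
(`vertexCoverBoxB10_iff`). NOT proved anywhere today for any `(β, q)`; the producers' object. [cite: WangEtAl2024, §III] -/
def VertexCoverBoxAt (β : ℝ) (q : ℚ) (U₁ U₂ : ℝ) : Prop :=
  ∃ S : Finset ((ℚ × ℚ) × (ℚ × ℚ)),
    (∀ U μ₀ : ℝ, U₁ ≤ U → U ≤ U₂ → InMuBand β 1 0 U (7 / 8) μ₀ → IsSupportingMu β 1 0 U (7 / 8) μ₀ →
      ∃ c ∈ S, ((c.1.1 : ℚ) : ℝ) ≤ U ∧ U ≤ ((c.1.2 : ℚ) : ℝ) ∧ ((c.2.1 : ℚ) : ℝ) ≤ μ₀ ∧ μ₀ ≤ ((c.2.2 : ℚ) : ℝ)) ∧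
      ∀ c ∈ S, ∃ d : CertDatum,
        RectCertAt β d ((c.1.1 : ℚ) : ℝ) ((c.1.2 : ℚ) : ℝ) ((c.2.1 : ℚ) : ℝ) ((c.2.2 : ℚ) : ℝ) ((q : ℚ) : ℝ)

/-- **The generic sub-box certificate statement** at `(β, q)` on `[U₁, U₂]` (the opener's `TrialGeneratorCertificateBoxB10` is the instance
`(10, 9/71, 79/10, 147/10)` up to the cast of the level). [cite: DLS1978, §2 eqs. (27), (28)] -/
def TrialGeneratorCertificateBoxAt (β : ℝ) (q : ℚ) (U₁ U₂ : ℝ) : Prop :=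
  ∀ U : ℝ, U₁ ≤ U → U ≤ U₂ → ∀ μ₀ : ℝ, InMuBand β 1 0 U (7 / 8) μ₀ → IsSupportingMu β 1 0 U (7 / 8) μ₀ →
    ∃ (r : ℕ) (a : FermionOp (box 2 r)), IsTrialGenerator r a ∧
      ∀ ω : InfVolFermionState 2, IsThermalRowState β 0 U (7 / 8) μ₀ ω →
        (ω.expect (box 2 (3 * r + 2)) (trialWord 0 U r a)).re ≤ ((q : ℚ) : ℝ)

/-- The registered S4 statement is literally the `(β, q, box) = (10, 9/71, [79/10, 147/10])` instance of the generic cover statement.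
[cite: WangEtAl2024, §III] -/
theorem vertexCoverBoxB10_iff : VertexCoverBoxB10 ↔ VertexCoverBoxAt 10 (9 / 71) (79 / 10) (147 / 10) := by
  have h971 : (((9 / 71 : ℚ)) : ℝ) = 9 / 71 := by push_cast; norm_num
  unfold VertexCoverBoxB10 VertexCoverBoxAt
  simp only [rectCertAt_ten, h971]

/-! ## §2 Generic bookkeeping (the proofs of `Theorems/TcThermcert1VertexComposition.lean` ∕ `…VertexLagrAffine.lean` with `10 ↦ β`) -/

/-- On a thermal row state at `(β; 0; U; 7/8; μ₀)` the generic Lagrangian dominates the objective (stationarity rows vanish, EEB and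
Bogoliubov rows are `≥ 0`, multipliers `≥ 0`). [cite: WangEtAl2024, §III] -/
theorem re_trialWord_le_lagrAt {β : ℝ} (d : CertDatum) {U μ₀ : ℝ} {ω : InfVolFermionState 2}
    (hω : IsThermalRowState β 0 U (7 / 8) μ₀ ω) :
    (ω.expect (box 2 (3 * d.r + 2)) (trialWord 0 U d.r d.a)).re ≤ lagrAt β d U μ₀ ω := by
  obtain ⟨_, _, hrows, hbog⟩ := hω
  have hst : (d.st.map fun ρ => (ρ.y * ω.expect ρ.Λ' (stWord 0 U μ₀ ρ.hΛ ρ.A)).re).sum = 0 := by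
    refine List.sum_eq_zero ?_
    intro x hx
    obtain ⟨ρ, _, rfl⟩ := List.mem_map.mp hx
    have h0 : ω.expect ρ.Λ' (stWord 0 U μ₀ ρ.hΛ ρ.A) = 0 := (hrows ρ.Λ ρ.Λ' ρ.hΛ ρ.h8 ρ.A).1
    simp [h0]
  have heeb : 0 ≤ (d.eeb.map fun ρ => ρ.y * (ω.expect ρ.Λ' (eebWord β 0 U μ₀ ρ.hΛ ρ.A ρ.s ρ.q)).re).sum := by
    refine List.sum_nonneg ?_
    intro x hx
    obtain ⟨ρ, _, rfl⟩ := List.mem_map.mp hx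
    exact mul_nonneg ρ.hy ((hrows ρ.Λ ρ.Λ' ρ.hΛ ρ.h8 ρ.A).2 ρ.s ρ.q ρ.hsq)
  have hbg : 0 ≤ (d.bog.map fun ρ => ρ.y * (ω.expect ρ.Λ' (bogWord β 0 U ρ.hΛ ρ.A ρ.C)).re).sum := by
    refine List.sum_nonneg ?_
    intro x hx
    obtain ⟨ρ, _, rfl⟩ := List.mem_map.mp hx
    exact mul_nonneg ρ.hy (hbog ρ.Λ ρ.Λ' ρ.hΛ ρ.h8 ρ.A ρ.C ρ.hAN ρ.hAS ρ.hCN ρ.hCS)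
  unfold lagrAt
  linarith

/-- `re` of a real-affine combination of complex numbers. [folklore] -/
private theorem re_affine (X Y : ℂ) (a b : ℝ) : ((a : ℂ) * X + (b : ℂ) * Y).re = a * X.re + b * Y.re := by
  simp only [Complex.add_re, Complex.re_ofReal_mul]

/-- `re` of a complex multiple of a real-affine combination. [folklore] -/
private theorem re_mul_affine (y X Y : ℂ) (a b : ℝ) :
    (y * ((a : ℂ) * X + (b : ℂ) * Y)).re = a * (y * X).re + b * (y * Y).re := by
  simp only [mul_add, Complex.add_re, Complex.mul_re, Complex.ofReal_re, Complex.ofReal_im, Complex.mul_im]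
  ring

/-- A finite `List.sum` commutes with affine combinations of the summands. [folklore] -/
private theorem list_sum_map_affine {α : Type*} (l : List α) (f g : α → ℝ) (θ : ℝ) :
    (l.map fun x => (1 - θ) * f x + θ * g x).sum = (1 - θ) * (l.map f).sum + θ * (l.map g).sum := by
  rw [List.sum_map_add, List.sum_map_mul_left, List.sum_map_mul_left]

/-- **S3 at every `β`**: the generic frozen-dual Lagrangian is jointly affine in `(U, μ₀)` along every line of the parameter plane
(the landed proof of `CertDatum.lagrAffine`, whose per-word lemmas `eebWord_affine` ∕ `bogWord_affine` already take `β`). [cite: WangEtAl2024, §III] -/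
theorem lagrAt_affine (β : ℝ) (d : CertDatum) : LagrAffineAt β d := by
  intro p₁ p₂ q₁ q₂ θ ω
  have hW : (ω.expect (box 2 (3 * d.r + 2)) (trialWord 0 ((1 - θ) * p₁ + θ * q₁) d.r d.a)).re =
      (1 - θ) * (ω.expect (box 2 (3 * d.r + 2)) (trialWord 0 p₁ d.r d.a)).re +
        θ * (ω.expect (box 2 (3 * d.r + 2)) (trialWord 0 q₁ d.r d.a)).re := by
    rw [trialWord_affine, map_add, map_smul, map_smul, smul_eq_mul, smul_eq_mul, re_affine]
  have hst : (d.st.map fun ρ => (ρ.y * ω.expect ρ.Λ' (stWord 0 ((1 - θ) * p₁ + θ * q₁) ((1 - θ) * p₂ + θ * q₂) ρ.hΛ ρ.A)).re) =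
      d.st.map fun ρ => (1 - θ) * (ρ.y * ω.expect ρ.Λ' (stWord 0 p₁ p₂ ρ.hΛ ρ.A)).re +
        θ * (ρ.y * ω.expect ρ.Λ' (stWord 0 q₁ q₂ ρ.hΛ ρ.A)).re :=
    List.map_congr_left fun ρ _ => by
      rw [stWord_affine, map_add, map_smul, map_smul, smul_eq_mul, smul_eq_mul, re_mul_affine]
  have heeb : (d.eeb.map fun ρ => ρ.y * (ω.expect ρ.Λ' (eebWord β 0 ((1 - θ) * p₁ + θ * q₁) ((1 - θ) * p₂ + θ * q₂) ρ.hΛ ρ.A ρ.s ρ.q)).re) =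
      d.eeb.map fun ρ => (1 - θ) * (ρ.y * (ω.expect ρ.Λ' (eebWord β 0 p₁ p₂ ρ.hΛ ρ.A ρ.s ρ.q)).re) +
        θ * (ρ.y * (ω.expect ρ.Λ' (eebWord β 0 q₁ q₂ ρ.hΛ ρ.A ρ.s ρ.q)).re) :=
    List.map_congr_left fun ρ _ => by
      rw [eebWord_affine, map_add, map_smul, map_smul, smul_eq_mul, smul_eq_mul, re_affine]; ring
  have hbog : (d.bog.map fun ρ => ρ.y * (ω.expect ρ.Λ' (bogWord β 0 ((1 - θ) * p₁ + θ * q₁) ρ.hΛ ρ.A ρ.C)).re) =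
      d.bog.map fun ρ => (1 - θ) * (ρ.y * (ω.expect ρ.Λ' (bogWord β 0 p₁ ρ.hΛ ρ.A ρ.C)).re) +
        θ * (ρ.y * (ω.expect ρ.Λ' (bogWord β 0 q₁ ρ.hΛ ρ.A ρ.C)).re) :=
    List.map_congr_left fun ρ _ => by
      rw [bogWord_affine, map_add, map_smul, map_smul, smul_eq_mul, smul_eq_mul, re_affine]; ring
  unfold lagrAt
  rw [hW, hst, heeb, hbog, list_sum_map_affine, list_sum_map_affine, list_sum_map_affine]
  ring

/-- **The cell (corner) rule at `β`**: a jointly affine `L_d^β` certified `≤ c` at the four corners of `[U₁,U₂] × [μ₁,μ₂]` is `≤ c` on the cell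
(two-step edge interpolation, `le_of_affine_of_endpoints`). [cite: WangEtAl2024, §III] -/
theorem lagrAt_le_of_rectCertAt {β : ℝ} (d : CertDatum) (haff : LagrAffineAt β d) {U₁ U₂ μ₁ μ₂ c U μ₀ : ℝ}
    (hcert : RectCertAt β d U₁ U₂ μ₁ μ₂ c) (hU₁ : U₁ ≤ U) (hU₂ : U ≤ U₂) (hμ₁ : μ₁ ≤ μ₀) (hμ₂ : μ₀ ≤ μ₂)
    {ω : InfVolFermionState 2} (hti : ω.IsTranslationInvariant) (hρ : ω.density = 7 / 8) :
    lagrAt β d U μ₀ ω ≤ c := by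
  obtain ⟨h₁₁, h₁₂, h₂₁, h₂₂⟩ := hcert ω hti hρ
  have hH : ∀ μ : ℝ, ∀ a b θ : ℝ,
      lagrAt β d ((1 - θ) * a + θ * b) μ ω = (1 - θ) * lagrAt β d a μ ω + θ * lagrAt β d b μ ω := by
    intro μ a b θ
    have h := haff a μ b μ θ ω
    rwa [show (1 - θ) * μ + θ * μ = μ by ring] at h
  have hV : ∀ u : ℝ, ∀ a b θ : ℝ,
      lagrAt β d u ((1 - θ) * a + θ * b) ω = (1 - θ) * lagrAt β d u a ω + θ * lagrAt β d u b ω := by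
    intro u a b θ
    have h := haff u a u b θ ω
    rwa [show (1 - θ) * u + θ * u = u by ring] at h
  have hlo : lagrAt β d U μ₁ ω ≤ c :=
    le_of_affine_of_endpoints (g := fun u => lagrAt β d u μ₁ ω) (hH μ₁) h₁₁ h₂₁ hU₁ hU₂
  have hhi : lagrAt β d U μ₂ ω ≤ c :=
    le_of_affine_of_endpoints (g := fun u => lagrAt β d u μ₂ ω) (hH μ₂) h₁₂ h₂₂ hU₁ hU₂
  exact le_of_affine_of_endpoints (g := fun m => lagrAt β d U m ω) (hV U) hlo hhi hμ₁ hμ₂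

/-! ## §3 Generic composition: cover ⇒ sub-box certificate ⇒ sub-box leaf (S1 and row admissibility from the tree) -/

/-- **Cover ⇒ certificate, at every `(β, q)` and sub-box** (affinity is a theorem at every `β`, so the cover is the ONLY input).
[cite: WangEtAl2024, §III] -/
theorem certificateBoxAt_of_vertexCoverAt {β : ℝ} {q : ℚ} {U₁ U₂ : ℝ} (hcov : VertexCoverBoxAt β q U₁ U₂) :
    TrialGeneratorCertificateBoxAt β q U₁ U₂ := by
  intro U hU hU' μ₀ hb hs
  obtain ⟨S, hS, hcert⟩ := hcov
  obtain ⟨c, hc, h₁, h₂, h₃, h₄⟩ := hS U μ₀ hU hU' hb hs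
  obtain ⟨d, hd⟩ := hcert c hc
  refine ⟨d.r, d.a, d.ha, fun ω hω => ?_⟩
  have hdom := re_trialWord_le_lagrAt (β := β) d hω
  have hcell := lagrAt_le_of_rectCertAt d (lagrAt_affine β d) hd h₁ h₂ h₃ h₄ hω.1 hω.2.1
  linarith

/-- **Certificate ⇒ leaf on the sub-box, at every `(β, q)` with `0 < β`, `0 ≤ U₁`**: the hook S1 (`Vertex.stub_trialGeneratorHook`, p614740) fed
through the proved row admissibility at the banded supporting `μ₀` of `exists_supportingMu_mem_band`. [cite: DLS1978, §2 eqs. (22'), (27), (28)] -/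
theorem boxLeafAt_of_certificateBoxAt {β : ℝ} (hβ : 0 < β) {q : ℚ} {U₁ U₂ : ℝ} (hU₁ : 0 ≤ U₁)
    (h : TrialGeneratorCertificateBoxAt β q U₁ U₂) :
    ∀ U : ℝ, U₁ ≤ U → U ≤ U₂ → ObsThermalStiffnessSeqCeilingAtBeta 0 U (7 / 8) β q := by
  intro U hU hU'
  have hU0 : (0 : ℝ) ≤ U := hU₁.trans hU
  obtain ⟨μ₀, hband, hsupp⟩ :=
    exists_supportingMu_mem_band (tp := 0) (U := U) (n := 7 / 8) (β := β) hU0 hβ (by norm_num) (by norm_num)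
  obtain ⟨r, a, ha, hcert⟩ := h U hU hU' μ₀ hband hsupp
  have hook : TrialGeneratorHook := stub_trialGeneratorHook
  refine hook (tp := 0) (U := U) (n := 7 / 8) (β := β) hβ (by norm_num) (by norm_num) r a ha ?_
  intro ω Ls hLs hω
  exact hcert ω (isThermalRowState_of_supportingMu hU0 hβ (by norm_num) (by norm_num) hsupp hLs hω)

/-- **Cover ⇒ leaf on the sub-box** (the generic line in one implication: S1, S3 and row admissibility are theorems, the cover is the input).
[cite: WangEtAl2024, §III] -/
theorem boxLeafAt_of_vertexCoverAt {β : ℝ} (hβ : 0 < β) {q : ℚ} {U₁ U₂ : ℝ} (hU₁ : 0 ≤ U₁) (hcov : VertexCoverBoxAt β q U₁ U₂) :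
    ∀ U : ℝ, U₁ ≤ U → U ≤ U₂ → ObsThermalStiffnessSeqCeilingAtBeta 0 U (7 / 8) β q :=
  boxLeafAt_of_certificateBoxAt hβ hU₁ (certificateBoxAt_of_vertexCoverAt hcov)

/-! ## §4 Cover algebra for incremental production (sliver first, then glue; raise the level; shrink the box; rational μ-strips) -/

/-- **Glue two adjacent sub-box covers** `[U₁, U₂]` and `[U₂, U₃]` into one on `[U₁, U₃]` (union of the cell sets). [cite: WangEtAl2024, §III] -/
theorem vertexCoverBoxAt_union {β : ℝ} {q : ℚ} {U₁ U₂ U₃ : ℝ} (h₁ : VertexCoverBoxAt β q U₁ U₂) (h₂ : VertexCoverBoxAt β q U₂ U₃) :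
    VertexCoverBoxAt β q U₁ U₃ := by
  classical
  obtain ⟨S₁, hS₁, hc₁⟩ := h₁
  obtain ⟨S₂, hS₂, hc₂⟩ := h₂
  refine ⟨S₁ ∪ S₂, fun U μ₀ hU hU' hb hs => ?_, fun c hc => ?_⟩
  · rcases le_total U U₂ with h | h
    · obtain ⟨c, hc, hrest⟩ := hS₁ U μ₀ hU h hb hs
      exact ⟨c, Finset.mem_union_left _ hc, hrest⟩
    · obtain ⟨c, hc, hrest⟩ := hS₂ U μ₀ h hU' hb hs
      exact ⟨c, Finset.mem_union_right _ hc, hrest⟩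
  · rcases Finset.mem_union.mp hc with hc | hc
    · exact hc₁ c hc
    · exact hc₂ c hc

/-- **Raise the level**: a cover at level `q` is a cover at every `q′ ≥ q`. [cite: WangEtAl2024, §III] -/
theorem vertexCoverBoxAt_mono {β : ℝ} {q q' : ℚ} {U₁ U₂ : ℝ} (h : VertexCoverBoxAt β q U₁ U₂) (hq : q ≤ q') :
    VertexCoverBoxAt β q' U₁ U₂ := by
  obtain ⟨S, hS, hc⟩ := h
  refine ⟨S, hS, fun c hcS => ?_⟩
  obtain ⟨d, hd⟩ := hc c hcS
  have hq' : ((q : ℚ) : ℝ) ≤ ((q' : ℚ) : ℝ) := by exact_mod_cast hq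
  refine ⟨d, fun ω hti hρ => ?_⟩
  obtain ⟨a₁, a₂, a₃, a₄⟩ := hd ω hti hρ
  exact ⟨a₁.trans hq', a₂.trans hq', a₃.trans hq', a₄.trans hq'⟩

/-- **Shrink the sub-box**: a cover of `[U₁, U₂]` covers every `[V₁, V₂] ⊆ [U₁, U₂]`. [cite: WangEtAl2024, §III] -/
theorem vertexCoverBoxAt_restrict {β : ℝ} {q : ℚ} {U₁ U₂ V₁ V₂ : ℝ} (h : VertexCoverBoxAt β q U₁ U₂) (hV₁ : U₁ ≤ V₁) (hV₂ : V₂ ≤ U₂) :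
    VertexCoverBoxAt β q V₁ V₂ := by
  obtain ⟨S, hS, hc⟩ := h
  exact ⟨S, fun U μ₀ hU hU' hb hs => hS U μ₀ (hV₁.trans hU) (hU'.trans hV₂) hb hs, hc⟩

/-- **Rational-friendly enclosure of the band at density `7/8`**: `band_β(U) ⊆ [−(2/7)/β − 4, 4 + U]` (`−2/7 ≤ log(7/9) ≤ 0`), so a cell
`[a, b] × [μ₁, μ₂]` with rational `μ₁ ≤ −(2/7)/β − 4` and `μ₂ ≥ 4 + b` spans the band for every `U ∈ [a, b]` and discharges the `InMuBand`
hypothesis of the cover condition without locating the supporting set. [cite: ArakiMoriya2003, Thm. 12.11] -/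
theorem muBand_enclosure {β U μ₀ : ℝ} (hβ : 0 < β) (h : InMuBand β 1 0 U (7 / 8) μ₀) :
    -(2 / 7) / β - 4 ≤ μ₀ ∧ μ₀ ≤ 4 + U := by
  obtain ⟨h₁, h₂⟩ := h
  have hx : (7 / 8 : ℝ) / (2 - 7 / 8) = 7 / 9 := by norm_num
  have h4 : (4 : ℝ) * |(1 : ℝ)| + 4 * |(0 : ℝ)| = 4 := by simp
  rw [hx, h4] at h₁
  rw [hx] at h₂
  have hlo : -(2 / 7 : ℝ) ≤ Real.log (7 / 9) := by
    have := Real.one_sub_inv_le_log_of_pos (show (0 : ℝ) < 7 / 9 by norm_num)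
    norm_num at this
    linarith
  have hhi : Real.log (7 / 9 : ℝ) ≤ 0 := Real.log_nonpos (by norm_num) (by norm_num)
  have hlo' : -(2 / 7) / β ≤ Real.log (7 / 9) / β := div_le_div_of_nonneg_right hlo hβ.le
  have hhi' : Real.log (7 / 9 : ℝ) / β ≤ 0 := div_nonpos_iff.mpr (Or.inr ⟨hhi, hβ.le⟩)
  have h4' : (4 : ℝ) * |(1 : ℝ)| + 4 * |(0 : ℝ)| + U = 4 + U := by simp
  rw [h4'] at h₂
  constructor
  · linarith
  · linarith

/-- **Single-strip constructor (the producer-facing entry point)**: ONE cell `[a, b] × [μ₁, μ₂]` whose rational μ-edges enclose the band for every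
`U ∈ [a, b]` (`μ₁ ≤ −(2/7)/β − 4`, `4 + b ≤ μ₂`, cf. `muBand_enclosure`) and which carries ONE frozen datum with its four corner certificates at level `q`
IS a cover of the sub-box `[a, b]` — no supporting-set information needed. A producer's first deliverable is therefore ONE claim
`∃ d, RectCertAt β d a b μ₁ μ₂ q` (e.g. `(β, q, a, b, μ₁, μ₂) = (6, 21/100, 79/10, 8, −81/20, 12)` for the sliver); wider sub-boxes are glued with
`vertexCoverBoxAt_union`. [cite: WangEtAl2024, §III] -/
theorem vertexCoverBoxAt_of_strip {β : ℝ} (hβ : 0 < β) {q a b μ₁ μ₂ : ℚ}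
    (hμ₁ : ((μ₁ : ℚ) : ℝ) ≤ -(2 / 7) / β - 4) (hμ₂ : 4 + ((b : ℚ) : ℝ) ≤ ((μ₂ : ℚ) : ℝ))
    (hcert : ∃ d : CertDatum, RectCertAt β d ((a : ℚ) : ℝ) ((b : ℚ) : ℝ) ((μ₁ : ℚ) : ℝ) ((μ₂ : ℚ) : ℝ) ((q : ℚ) : ℝ)) :
    VertexCoverBoxAt β q ((a : ℚ) : ℝ) ((b : ℚ) : ℝ) := by
  classical
  refine ⟨{((a, b), (μ₁, μ₂))}, fun U μ₀ hU hU' hb _ => ?_, fun c hc => ?_⟩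
  · obtain ⟨hlo, hhi⟩ := muBand_enclosure hβ hb
    exact ⟨((a, b), (μ₁, μ₂)), Finset.mem_singleton_self _, hU, hU', hμ₁.trans hlo,
      show μ₀ ≤ ((μ₂ : ℚ) : ℝ) by linarith⟩
  · rw [Finset.mem_singleton] at hc
    subst hc
    exact hcert

/-- **The sliver instance at `β·t = 6`** (first production target of the plan, ORDER (b) of the card): one strip claim on `[79/10, 8] × [−81/20, 12]` at
level `21/100` gives the cover of the sliver, hence (by `subBoxLeaf_b6` below) the leaf `21/100` at `β·t = 6` for every `U ∈ [7.9, 8]`.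
(`−81/20 = −4.05 ≤ −(2/7)/6 − 4 = −4.0476…`, `4 + 8 ≤ 12`.) [cite: WangEtAl2024, §III] -/
theorem sliverCover_b6_of_strip (hcert : ∃ d : CertDatum, RectCertAt 6 d (79 / 10) 8 (-81 / 20) 12 (21 / 100)) :
    VertexCoverBoxAt 6 (21 / 100) (79 / 10) 8 := by
  have h := vertexCoverBoxAt_of_strip (β := 6) (q := 21 / 100) (a := 79 / 10) (b := 8) (μ₁ := -81 / 20) (μ₂ := 12)
    (by norm_num) (by push_cast; norm_num) (by push_cast; norm_num) (by push_cast; exact hcert)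
  push_cast at h
  exact h

/-! ## §5 The rungs (implications; their antecedents are producers' objects, proved nowhere today) -/

/-- **K2-side M-K1-R1 lever-level rung, BOX-WIDE**: a cell cover at `β·t = 6`, level `21/100`, of the object-E box gives the thermal KT
ceiling `T_c ≤ t/6` on the whole box `U/t ∈ [7.9, 14.7]` (`(π/4)·(21/100) = 0.1649 < 1/6`; today's box value of record is `10/33`, energy class).
Helper toward stmt-Ventures-26382 (same lever, lower `β`), NOT a new item. [cite: HazraVermaRanderia2019, eqs. (2)–(4)] -/
theorem rungBox_b6 (h : VertexCoverBoxAt 6 (21 / 100) (79 / 10) (147 / 10)) : S3ThermalTcCeilingBoxAt_n7o8_tp0 (1 / 6) := by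
  refine S3ThermalTcCeilingBoxAt_n7o8_tp0_of_leafAtBeta (β := 6) (by norm_num) ?_ (by push_cast; norm_num)
    (boxLeafAt_of_vertexCoverAt (by norm_num) (by norm_num) h)
  have hπ : Real.pi < 3.15 := Real.pi_lt_d2
  push_cast
  nlinarith

/-- **K2-side by-product rung at `β·t = 5`, BOX-WIDE**: a cell cover at level `14/55` gives `T_c ≤ t/5` on the whole box
(`(π/4)·(14/55) = 0.19992 < 1/5`, needs `π < 3.1416`). Helper, NOT a new item. [cite: HazraVermaRanderia2019, eqs. (2)–(4)] -/
theorem rungBox_b5 (h : VertexCoverBoxAt 5 (14 / 55) (79 / 10) (147 / 10)) : S3ThermalTcCeilingBoxAt_n7o8_tp0 (1 / 5) := by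
  refine S3ThermalTcCeilingBoxAt_n7o8_tp0_of_leafAtBeta (β := 5) (by norm_num) ?_ (by push_cast; norm_num)
    (boxLeafAt_of_vertexCoverAt (by norm_num) (by norm_num) h)
  have hπ : Real.pi < 3.1416 := Real.pi_lt_d4
  push_cast
  nlinarith

/-- **K2-side twin of MILESTONE M-K1-R1(8) (lead RULINGS R149 (b) ∕ R150), BOX-WIDE**: a cell cover at `β·t = 8`, level `7/44`, of the object-E box
gives `T_c ≤ t/8` on the whole box (`(π/4)·(7/44) = 0.124950 < 1/8 ⟺ π < 22/7`, `Real.pi_lt_d4`; the K1 sibling rung is plan-1's `RungB8.rung_b8` at the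
one point `U = 8`). Helper, NOT a new item. [cite: HazraVermaRanderia2019, eqs. (2)–(4)] -/
theorem rungBox_b8 (h : VertexCoverBoxAt 8 (7 / 44) (79 / 10) (147 / 10)) : S3ThermalTcCeilingBoxAt_n7o8_tp0 (1 / 8) := by
  refine S3ThermalTcCeilingBoxAt_n7o8_tp0_of_leafAtBeta (β := 8) (by norm_num) ?_ (by push_cast; norm_num)
    (boxLeafAt_of_vertexCoverAt (by norm_num) (by norm_num) h)
  have hπ : Real.pi < 3.1416 := Real.pi_lt_d4
  push_cast
  nlinarith

/-- **Sub-box form of the `β·t = 8` rung** (sliver-first production at M-K1-R1(8)'s temperature). [cite: HazraVermaRanderia2019, eqs. (2)–(4)] -/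
theorem subBoxLeaf_b8 {U₁ U₂ : ℝ} (hU₁ : 0 ≤ U₁) (h : VertexCoverBoxAt 8 (7 / 44) U₁ U₂) :
    ∀ U : ℝ, U₁ ≤ U → U ≤ U₂ → ObsThermalStiffnessSeqCeilingAtBeta 0 U (7 / 8) 8 (7 / 44) :=
  boxLeafAt_of_vertexCoverAt (by norm_num) hU₁ h

/-- **The sliver instance at `β·t = 8`**: one strip claim on `[79/10, 8] × [−81/20, 12]` at level `7/44` covers the sliver
(`−81/20 ≤ −(2/7)/8 − 4 = −4.0357…`). [cite: WangEtAl2024, §III] -/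
theorem sliverCover_b8_of_strip (hcert : ∃ d : CertDatum, RectCertAt 8 d (79 / 10) 8 (-81 / 20) 12 (7 / 44)) :
    VertexCoverBoxAt 8 (7 / 44) (79 / 10) 8 := by
  have h := vertexCoverBoxAt_of_strip (β := 8) (q := 7 / 44) (a := 79 / 10) (b := 8) (μ₁ := -81 / 20) (μ₂ := 12)
    (by norm_num) (by push_cast; norm_num) (by push_cast; norm_num) (by push_cast; exact hcert)
  push_cast at h
  exact h

/-- **Sub-box form of the `β·t = 6` rung** (sliver-first production: a cover of `[U₁, U₂] ⊆ box`, `0 ≤ U₁`, already gives the leaf `21/100` at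
`β·t = 6` for every `U` of the sub-box; glue slivers with `vertexCoverBoxAt_union` until the box is reached). [cite: HazraVermaRanderia2019, eqs. (2)–(4)] -/
theorem subBoxLeaf_b6 {U₁ U₂ : ℝ} (hU₁ : 0 ≤ U₁) (h : VertexCoverBoxAt 6 (21 / 100) U₁ U₂) :
    ∀ U : ℝ, U₁ ≤ U → U ≤ U₂ → ObsThermalStiffnessSeqCeilingAtBeta 0 U (7 / 8) 6 (21 / 100) :=
  boxLeafAt_of_vertexCoverAt (by norm_num) hU₁ h

/-- **The K2 instance through the generic sockets**: the `(10, 9/71, box)` cover gives the crux decl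
`Summit.Ventures.CertifiedManyBodySolver.Theses.TcThermcert1.ThermalStiffnessCeilingBoxb10_le_9o71` (stmt-Ventures-26382) BY NAME — consistent with
the registered skeleton (`Vertex.ThermalStiffnessCeilingBoxb10_le_9o71_of_vertexCover` ∘ `vertexCoverBoxB10_iff`); CONDITIONAL, nothing
discharges the cover here. [cite: WangEtAl2024, §III] -/
theorem crux_of_vertexCoverAt (h : VertexCoverBoxAt 10 (9 / 71) (79 / 10) (147 / 10)) : ThermalStiffnessCeilingBoxb10_le_9o71 :=
  fun _ => boxLeafAt_of_vertexCoverAt (by norm_num) (by norm_num) h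

/-- The same instance read through the registered route: generic cover at `(10, 9/71, box)` ⇒ registered S4 ⇒ K2. [cite: WangEtAl2024, §III] -/
theorem crux_of_vertexCoverAt' (h : VertexCoverBoxAt 10 (9 / 71) (79 / 10) (147 / 10)) : ThermalStiffnessCeilingBoxb10_le_9o71 :=
  ThermalStiffnessCeilingBoxb10_le_9o71_of_vertexCover (vertexCoverBoxB10_iff.mpr h)

end Summit.Ventures.CertifiedManyBodySolver.Cruxes.ThermalStiffnessCeilingBoxb10_le_9o71.VertexRungs

end
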